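import Literature.Analysis.FluidPDE.TorusClassicalH1Balance
import HarnessLib

/-!
# The even-order Sobolev balances `d/dt ½‖Δⁿu‖₂²` of classical Navier–Stokes solutions on the torus

Analysis/FluidPDE proof file (theorems only; no definitions, no named facts), sequel of
`TorusClassicalH1Balance.lean`. For a classical solution `(u, p)` of the forced incompressible
Navier–Stokes system on `T^d × [a, b]` (`Torus.IsClassicalNSSolutionOn (Icc a b) ν f u p`) and
every `n : ℕ`, the quantity `½‖Δⁿu(t)‖₂² = ½ ∫ ‖Δⁿu(t)‖²` (`‖u(t)‖²_{Ḣ^{2n}}` up to `(4π²)^{2n}`)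
has the one-sided derivative

`d/dt ½‖Δⁿu‖₂² = −ν ‖∇Δⁿu‖₂² − ∫ ⟪(u·∇)u − f, Δ²ⁿu⟫`

within `[a, b]` (`Torus.IsClassicalNSSolutionOn.hasDerivWithinAt_half_integral_norm_sq_laplacian_iterate`):
differentiate under the integral, commute `∂ₜ` with `Δⁿ`
(`Torus.timeDerivWithin_laplacian_iterate_comm`), move `Δⁿ` across by Green's second identity
(`Torus.integral_inner_laplacian_iterate_comm`), insert the momentum equation, and drop the
pressure (`Δ²ⁿu` is divergence free, `Torus.IsDivFree.laplacian_iterate_of_isSmooth`). The case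
`n = 0` is the energy equation, and pairing with `Δ²ⁿu` for all `n` is the "inner product of the
momentum equation with `Aᵐu`" behind every higher-order energy estimate of space-periodic flows
(Foias–Manley–Rosa–Temam 2001, Ch. II App. A (A.55) for `m = 1` and Ch. II §7; Constantin–Foias
1988, Ch. 10; Majda–Bertozzi 2002, Prop. 3.7 for the `H^m` energy method).

Filed in support of the named fact
`Literature.Analysis.FluidPDE.bmn1999_rotating_ns_global_regularity` (Babin–Mahalov–Nicolaenko
1999, whose §5 runs on `H^α` energy estimates of this type, uniform in the rotation because the
Coriolis term is `L²`-orthogonal to every `Δᵐu`, `NSCoriolisLaplacian.lean`).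

* `Torus.integral_inner_laplacian_iterate_comm` — `∫ ⟪Δⁿv, w⟫ = ∫ ⟪v, Δⁿw⟫` (Green, iterated);
* `Torus.IsDivFree.laplacian_iterate_of_isSmooth` — `div u = 0 ⇒ div Δⁿu = 0`;
* `Torus.integral_inner_laplacian_self_eq_neg_gradNormSq` — `∫ ⟪Δw, w⟫ = −‖∇w‖₂²`;
* `Torus.IsClassicalNSSolutionOn.hasDerivWithinAt_half_integral_norm_sq_laplacian_iterate` — the
  balance.

## Mathlib / tree search

Tree (reused): `Torus.timeDerivWithin_laplacian_iterate_comm`, `Torus.IsSmoothSpaceTimeOn.laplacian_iterate`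
(`TorusInverseLaplacianCalculus`, `TorusInverseLaplacian`), `Torus.isSmooth_laplacian_iterate`
(`TorusFourierConvolution`), `Torus.integral_inner_laplacian_comm`, `Torus.integral_inner_laplacian_eq_neg_holds`
(`TorusFluidGlueProofs`, `TorusCalculusProofs`), `Torus.IsDivFree.laplacian_of_isSmooth`,
`Torus.integral_inner_gradient_eq_zero_of_isDivFree` (`TorusClassicalH1Balance` and its imports),
`Torus.IsSmoothSpaceTimeOn.hasDerivWithinAt_integral`, `….hasDerivWithinAt_slice`. Searched
`laplacian_iterate` with `hasDerivWithinAt`, `H2 balance`, `Hm balance` for classical torus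
solutions: none (the tree's `H^m` energy identities are for Galerkin trigonometric polynomials,
`GalerkinSmoothHm`).

## References

* C. Foias, O. Manley, R. Rosa, R. Temam, *Navier–Stokes Equations and Turbulence*, CUP 2001,
  Ch. II App. A (A.55) and §7. [FoiasManleyRosaTemam2001]
* A. J. Majda, A. L. Bertozzi, *Vorticity and Incompressible Flow*, CUP 2002, §3.2, Prop. 3.7
  (the `H^m` energy estimate). [MajdaBertozziCUP2002]
* A. Babin, A. Mahalov, B. Nicolaenko, Indiana Univ. Math. J. 48 (1999), §5.
  [BabinMahalovNicolaenko1999]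
-/

noncomputable section

open MeasureTheory Set Function
open scoped ContDiff InnerProductSpace RealInnerProductSpace

namespace Literature.Analysis.FluidPDE

open Literature.Analysis.FunctionSpaces

variable {d : Type*} [Fintype d] [DecidableEq d]

/-! ### Torus calculus complements -/

/-- **Green's second identity, iterated**: `∫ ⟪Δⁿv, w⟫ = ∫ ⟪v, Δⁿw⟫` for smooth fields on the
torus with values in a real inner product space. [folklore] -/
theorem Torus.integral_inner_laplacian_iterate_comm {G : Type*} [NormedAddCommGroup G]
    [InnerProductSpace ℝ G] :
    ∀ (n : ℕ) {v w : UnitAddTorus d → G}, Torus.IsSmooth v → Torus.IsSmooth w →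
      ∫ x, ⟪(Torus.laplacian^[n] v) x, w x⟫ = ∫ x, ⟪v x, (Torus.laplacian^[n] w) x⟫
  | 0, _, _, _, _ => rfl
  | n + 1, v, w, hv, hw => by
    have hΔv : Torus.IsSmooth (Torus.laplacian v) := hv.laplacian
    have hnw : Torus.IsSmooth (Torus.laplacian^[n] w) := Torus.isSmooth_laplacian_iterate hw n
    calc ∫ x, ⟪(Torus.laplacian^[n + 1] v) x, w x⟫
        = ∫ x, ⟪(Torus.laplacian^[n] (Torus.laplacian v)) x, w x⟫ := by
          simp only [Function.iterate_succ_apply]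
      _ = ∫ x, ⟪Torus.laplacian v x, (Torus.laplacian^[n] w) x⟫ :=
          Torus.integral_inner_laplacian_iterate_comm n hΔv hw
      _ = ∫ x, ⟪v x, Torus.laplacian (Torus.laplacian^[n] w) x⟫ :=
          Torus.integral_inner_laplacian_comm hv hnw
      _ = ∫ x, ⟪v x, (Torus.laplacian^[n + 1] w) x⟫ := by
          simp only [Function.iterate_succ_apply']

/-- **Iterated Laplacians of a smooth divergence-free field are divergence free.** [folklore] -/
theorem Torus.IsDivFree.laplacian_iterate_of_isSmooth {u : UnitAddTorus d → EuclideanSpace ℝ d}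
    (hu : Torus.IsSmooth u) (hdiv : Torus.IsDivFree u) :
    ∀ n : ℕ, Torus.IsDivFree (Torus.laplacian^[n] u)
  | 0 => hdiv
  | n + 1 => by
    rw [Function.iterate_succ_apply']
    exact Torus.IsDivFree.laplacian_of_isSmooth (Torus.isSmooth_laplacian_iterate hu n)
      (Torus.IsDivFree.laplacian_iterate_of_isSmooth hu hdiv n)

/-- `∫ ⟪Δw, w⟫ = −‖∇w‖₂²` (`Torus.gradNormSq`) for a smooth real vector field (Green's first
identity `Torus.integral_inner_laplacian_eq_neg_holds`). [folklore] -/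
theorem Torus.integral_inner_laplacian_self_eq_neg_gradNormSq {w : UnitAddTorus d → EuclideanSpace ℝ d}
    (hw : Torus.IsSmooth w) :
    ∫ x, ⟪Torus.laplacian w x, w x⟫ = -Torus.gradNormSq w := by
  have h := Torus.integral_inner_laplacian_eq_neg_holds (d := d) hw
  have hcomm : ∫ x, ⟪Torus.laplacian w x, w x⟫ = ∫ x, ⟪w x, Torus.laplacian w x⟫ :=
    integral_congr_ae (ae_of_all _ fun x => real_inner_comm _ _)
  have hint : ∀ i, Integrable (fun x => ‖Torus.partialDeriv i w x‖ ^ 2) volume := fun i =>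
    ((hw.partialDeriv i).continuous.norm.pow 2).integrable_unitAddTorus
  rw [hcomm, h, Torus.gradNormSq, integral_finsetSum _ fun i _ => hint i]

/-! ### The balance of `½‖Δⁿu‖₂²` -/

/-- **The even-order Sobolev balances of classical Navier–Stokes solutions on the torus.** For a
classical solution of `∂ₜu + (u·∇)u = νΔu − ∇p + f`, `div u = 0` on `T^d × [a, b]`, `a < b`, every
`n : ℕ` and every `t ∈ [a, b]`,
`d/dt ½ ∫ ‖Δⁿu(t)‖² = −ν ‖∇Δⁿu(t)‖₂² − ∫ ⟪(u·∇)u(t) − f(t), Δ²ⁿu(t)⟫`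
as a one-sided derivative within `[a, b]` ("the inner product of the momentum equation with
`A²ⁿu`"; `n = 0` is the energy equation, FMRT 2001 Ch. II (7.4); the general case is the identity
behind the `H^m` energy method, Majda–Bertozzi 2002, Prop. 3.7). The pressure drops out because
`Δ²ⁿu` is divergence free. [cite: FoiasManleyRosaTemam2001, Ch. II App. A (A.55) and §7] -/
theorem _root_.Literature.Analysis.FunctionSpaces.Torus.IsClassicalNSSolutionOn.hasDerivWithinAt_half_integral_norm_sq_laplacian_iterate
    {a b ν : ℝ} {f u : ℝ → UnitAddTorus d → EuclideanSpace ℝ d} {p : ℝ → UnitAddTorus d → ℝ}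
    (h : Torus.IsClassicalNSSolutionOn (Icc a b) ν f u p) (hab : a < b) (n : ℕ) {t : ℝ}
    (ht : t ∈ Icc a b) :
    HasDerivWithinAt (fun s => 2⁻¹ * ∫ x, ‖(Torus.laplacian^[n] (u s)) x‖ ^ 2)
      (-ν * Torus.gradNormSq (Torus.laplacian^[n] (u t)) -
        ∫ x, ⟪Torus.convect (u t) (u t) x - f t x, (Torus.laplacian^[2 * n] (u t)) x⟫) (Icc a b) t := by
  set S : Set ℝ := Icc a b with hSdef
  have hSc : Convex ℝ S := convex_Icc a b
  have hU : UniqueDiffOn ℝ S := uniqueDiffOn_Icc hab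
  have hu : Torus.IsSmoothSpaceTimeOn S u := h.smooth_velocity
  have hut : Torus.IsSmooth (u t) := hu.isSmooth_slice ht
  have hpt : Torus.IsSmooth (p t) := h.smooth_pressure.isSmooth_slice ht
  have hA : Torus.IsSmooth (Torus.timeDerivWithin S u t) := hu.isSmooth_timeDerivWithin hU ht
  have hWst : Torus.IsSmoothSpaceTimeOn S (fun s => Torus.laplacian^[n] (u s)) := hu.laplacian_iterate hU n
  have hW : Torus.IsSmooth (Torus.laplacian^[n] (u t)) := Torus.isSmooth_laplacian_iterate hut n
  have hZ : Torus.IsSmooth (Torus.laplacian^[2 * n] (u t)) := Torus.isSmooth_laplacian_iterate hut (2 * n)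
  -- Step 1: differentiate `½ ∫ ‖Δⁿu‖²` under the integral sign.
  have hφ : Torus.IsSmoothSpaceTimeOn S (fun s x => ‖(Torus.laplacian^[n] (u s)) x‖ ^ 2) := hWst.norm_sq ℝ
  have hE : HasDerivWithinAt (fun s => 2⁻¹ * ∫ x, ‖(Torus.laplacian^[n] (u s)) x‖ ^ 2)
      (2⁻¹ * ∫ x, Torus.timeDerivWithin S
        (fun s x => ‖(Torus.laplacian^[n] (u s)) x‖ ^ 2) t x) S t :=
    (hφ.hasDerivWithinAt_integral hSc ht).const_mul 2⁻¹
  -- Step 2: `∂ₜ ‖Δⁿu‖² = 2 ⟪Δⁿ∂ₜu, Δⁿu⟫`.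
  have htd : ∀ x, Torus.timeDerivWithin S (fun s x => ‖(Torus.laplacian^[n] (u s)) x‖ ^ 2) t x =
      2 * ⟪(Torus.laplacian^[n] (Torus.timeDerivWithin S u t)) x, (Torus.laplacian^[n] (u t)) x⟫ := by
    intro x
    have h1 := ((hWst.hasDerivWithinAt_slice ht x).norm_sq).derivWithin (hU t ht)
    rw [Torus.timeDerivWithin, h1, ← Torus.timeDerivWithin_laplacian_iterate_comm hab hu n ht x,
      real_inner_comm]
  -- Step 3: Green, `∫ ⟪Δⁿ∂ₜu, Δⁿu⟫ = ∫ ⟪∂ₜu, Δ²ⁿu⟫`.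
  have h2n : ∀ v : UnitAddTorus d → EuclideanSpace ℝ d,
      Torus.laplacian^[n] (Torus.laplacian^[n] v) = Torus.laplacian^[2 * n] v := fun v => by
    rw [← Function.iterate_add_apply, two_mul]
  have hE' : 2⁻¹ * ∫ x, Torus.timeDerivWithin S
        (fun s x => ‖(Torus.laplacian^[n] (u s)) x‖ ^ 2) t x =
      ∫ x, ⟪Torus.timeDerivWithin S u t x, (Torus.laplacian^[2 * n] (u t)) x⟫ := by
    simp_rw [htd, integral_const_mul]
    rw [Torus.integral_inner_laplacian_iterate_comm n hA hW, h2n]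
    ring
  rw [hE'] at hE
  convert hE using 1
  -- Step 4: insert the momentum equation; the pressure term drops out.
  have hA_eq : ∀ x, Torus.timeDerivWithin S u t x = ν • Torus.laplacian (u t) x -
      Torus.gradient (p t) x + f t x - Torus.convect (u t) (u t) x := by
    intro x
    rw [← h.momentum t ht x]
    abel
  have hΔ : Torus.IsSmooth (Torus.laplacian (u t)) := hut.laplacian
  have iL : Integrable (fun x => ⟪ν • Torus.laplacian (u t) x, (Torus.laplacian^[2 * n] (u t)) x⟫) volume :=
    ((hΔ.smul ν).inner hZ).integrable
  have iG : Integrable (fun x => ⟪Torus.gradient (p t) x, (Torus.laplacian^[2 * n] (u t)) x⟫) volume :=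
    (hpt.gradient.inner hZ).integrable
  have hf : Torus.IsSmooth (fun x => f t x) := by
    have hfun : (fun x => f t x) = fun x => Torus.timeDerivWithin S u t x +
        Torus.convect (u t) (u t) x - ν • Torus.laplacian (u t) x + Torus.gradient (p t) x := by
      funext x
      rw [h.momentum t ht x]
      abel
    rw [hfun]
    exact ((hA.add (hut.convect hut)).sub (hΔ.smul ν)).add hpt.gradient
  have iF : Integrable (fun x => ⟪f t x, (Torus.laplacian^[2 * n] (u t)) x⟫) volume :=
    (hf.inner hZ).integrable
  have iC : Integrable (fun x => ⟪Torus.convect (u t) (u t) x, (Torus.laplacian^[2 * n] (u t)) x⟫) volume :=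
    ((hut.convect hut).inner hZ).integrable
  have hsplit : ∫ x, ⟪Torus.timeDerivWithin S u t x, (Torus.laplacian^[2 * n] (u t)) x⟫ =
      (∫ x, ⟪ν • Torus.laplacian (u t) x, (Torus.laplacian^[2 * n] (u t)) x⟫) -
        (∫ x, ⟪Torus.gradient (p t) x, (Torus.laplacian^[2 * n] (u t)) x⟫) +
        (∫ x, ⟪f t x, (Torus.laplacian^[2 * n] (u t)) x⟫) -
        ∫ x, ⟪Torus.convect (u t) (u t) x, (Torus.laplacian^[2 * n] (u t)) x⟫ := by
    simp_rw [hA_eq, inner_sub_left, inner_add_left, inner_sub_left]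
    rw [integral_sub ?_ iC, integral_add ?_ iF, integral_sub iL iG]
    · exact iL.sub iG
    · exact (iL.sub iG).add iF
  -- the viscous term: `ν ∫ ⟪Δu, Δ²ⁿu⟫ = ν ∫ ⟪Δⁿ(Δu), Δⁿu⟫ = ν ∫ ⟪Δ(Δⁿu), Δⁿu⟫ = −ν ‖∇Δⁿu‖₂²`
  have hvisc : ∫ x, ⟪ν • Torus.laplacian (u t) x, (Torus.laplacian^[2 * n] (u t)) x⟫ =
      -ν * Torus.gradNormSq (Torus.laplacian^[n] (u t)) := by
    have e1 : ∫ x, ⟪ν • Torus.laplacian (u t) x, (Torus.laplacian^[2 * n] (u t)) x⟫ =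
        ν * ∫ x, ⟪Torus.laplacian (u t) x, (Torus.laplacian^[n] (Torus.laplacian^[n] (u t))) x⟫ := by
      rw [← integral_const_mul, h2n]
      refine integral_congr_ae (ae_of_all _ fun x => ?_)
      simp only [real_inner_smul_left]
    have e2 : ∫ x, ⟪Torus.laplacian (u t) x, (Torus.laplacian^[n] (Torus.laplacian^[n] (u t))) x⟫ =
        ∫ x, ⟪(Torus.laplacian^[n] (Torus.laplacian (u t))) x, (Torus.laplacian^[n] (u t)) x⟫ :=
      (Torus.integral_inner_laplacian_iterate_comm n hΔ hW).symm
    have e3 : Torus.laplacian^[n] (Torus.laplacian (u t)) = Torus.laplacian (Torus.laplacian^[n] (u t)) := by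
      rw [← Function.iterate_succ_apply, Function.iterate_succ_apply']
    rw [e1, e2, e3, Torus.integral_inner_laplacian_self_eq_neg_gradNormSq hW]
    ring
  have hpres : ∫ x, ⟪Torus.gradient (p t) x, (Torus.laplacian^[2 * n] (u t)) x⟫ = 0 :=
    Torus.integral_inner_gradient_eq_zero_of_isDivFree hZ hpt
      (Torus.IsDivFree.laplacian_iterate_of_isSmooth hut (h.divFree t ht) (2 * n))
  have hCF : ∫ x, ⟪Torus.convect (u t) (u t) x - f t x, (Torus.laplacian^[2 * n] (u t)) x⟫ =
      (∫ x, ⟪Torus.convect (u t) (u t) x, (Torus.laplacian^[2 * n] (u t)) x⟫) -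
        ∫ x, ⟪f t x, (Torus.laplacian^[2 * n] (u t)) x⟫ := by
    simp_rw [inner_sub_left]
    exact integral_sub iC iF
  rw [hsplit, hvisc, hpres, hCF]
  ring

end Literature.Analysis.FluidPDE

end
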